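import Mathlib
import HarnessLib
import Literature.Analysis.SpecialFunctions.LogChooseStirling
import Summits.KontsevichZagierPeriods.Zeta5Search.Denom.TwoTaleR3Forms
import Summits.KontsevichZagierPeriods.Zeta5Search.TwoTaleP15GrowthLimit
import Summits.KontsevichZagierPeriods.Zeta5Search.TwoTaleR3Growth

/-!
# TwoTaleR3GrowthLimit — `log (qhatA n) / n → C₁*`, `WhippleA → CoeffRateA C₁*`, and the packaged rung-A implication

HONEST FRAMING: systematic search; no irrationality claim unless certified.

fam-measure (pub-zeta5), `families/measure/FAMILY.md` §10.5 / §10.10.  Sequel of `TwoTaleR3Growth` (one development,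
split for the 400-line cap; the rung-A port of `TwoTaleP15GrowthLimit`).  THIS PART:
* the LOWER bound at the near-critical index `k_n = ⌊ustarA·n⌋` (`exp_le_termA_kcrit`: the tree's Stirling bound
  `log_choose_ge_entropy` plus `KL ≤ χ²`, via `TwoTaleP15Growth.exp_le_choose`, turns the entropy into the affine
  Chernoff form minus the bounded penalty `penPA + 2·log(15n) + 8`);
* **`tendsto_log_qhatA_div`** (PROVED, unconditional): `log (qhatA n) / n → C₁starA`;
* **`coeffRateA_of_whipple : WhippleA → CoeffRateA C₁starA`**, **`C₁starA_pos`** (`C(4n,2n) ≤ qhatA n`);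
* packaged (PROVED implications, the growth inputs `CoeffRateA C₁`, `0 < C₁` of fam-denom's
  `Denom.TwoTaleR3Forms.exponentLE_of_inputsA` replaced by `WhippleA`): `exponentLE_of_whippleA`,
  `zetaTwo_exponent_le_of_whippleA : InclusionA → DecayA 13.229 → WhippleA → C₁starA ≤ 18.7553 →
  ExponentLE (zetaValue 2) 5.2054` and the loose `… → DecayA 13.2 → WhippleA → C₁starA ≤ 18.8 → ExponentLE (zetaValue 2)
  5.233` (the enclosure hypothesis `C₁starA ≤ 18.7553` is discharged in `TwoTaleR3GrowthEnclosure`).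

NOTHING here certifies a measure: `InclusionA`, `DecayA` and `WhippleA` remain named inputs.  The printed value at the
point is `μ(ζ(2)) ≤ 5.20514736…` [Zudilin2014ZetaTwo, Remark 3] (not a record; rung A is the (bmiss)-free rung).
References: W. N. Bailey, Generalized hypergeometric series (1935) §4.5; W. Zudilin, arXiv:1310.1526 [Zudilin2014ZetaTwo]
§6, Remarks 3 and 5.
-/

noncomputable section

open Filter Topology Finset Real

namespace Summit.KontsevichZagierPeriods.Zeta5Search.TwoTaleR3Growth

open Summit.KontsevichZagierPeriods.Zeta5Search.Denom.TwoTaleR3Forms (formQA CoeffRateA)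
open Summit.KontsevichZagierPeriods.Zeta5Search.TwoTaleP15Growth (choose_le_exp exp_le_choose prod4_le pen_le
  tendsto_log_linear_div)

/-! ### Lower bound for `qhatA` at the near-critical index -/

/-- The near-critical index `k_n = ⌊u*·n⌋`. -/
def kcritA (n : ℕ) : ℕ := ⌊ustarA * n⌋₊

/-- `k_n ≤ u*·n < k_n + 1`. -/
theorem kcritA_real (n : ℕ) : (kcritA n : ℝ) ≤ ustarA * n ∧ ustarA * n < kcritA n + 1 :=
  ⟨Nat.floor_le (by have := ustarA_bounds.1; positivity), Nat.lt_floor_add_one _⟩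

/-- `9n ≤ k_n < 11n` for `n ≥ 1` (from `9 ≤ u* ≤ 21/2`). -/
theorem kcritA_range {n : ℕ} (hn : 1 ≤ n) : 9 * n ≤ kcritA n ∧ kcritA n < 11 * n := by
  have h1 := ustarA_spec.1.1
  have h2 := ustarA_spec.1.2
  have hn' : (1:ℝ) ≤ n := by exact_mod_cast hn
  constructor
  · apply Nat.le_floor
    push_cast
    nlinarith
  · unfold kcritA
    rw [Nat.floor_lt (by positivity)]
    push_cast
    nlinarith

/-- **Lower half**: the single summand at `k_n = ⌊u* n⌋` is within a bounded-times-polynomial factor of the tangent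
plane: `exp(n·C₁* + K₀(u*) − P − 2·log(15n) − 8) ≤ termA n k_n` for `n ≥ 1`. -/
theorem exp_le_termA_kcrit {n : ℕ} (hn : 1 ≤ n) :
    Real.exp (n * C₁starA + constKA ustarA - penPA - 2 * Real.log (15 * n) - 8) ≤ (termA n (kcritA n) : ℝ) := by
  obtain ⟨h9, h11⟩ := kcritA_range hn
  obtain ⟨hx0, hx1⟩ := kcritA_real n
  obtain ⟨hu1, hu2⟩ := ustarA_bounds
  have h9u := ustarA_spec.1.1
  have hG := ustarA_spec.2
  obtain ⟨⟨a0, b0⟩, ⟨a1, b1⟩, ⟨a2, b2⟩, ⟨a3, b3⟩⟩ := slopes_mem hu1 hu2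
  set K := kcritA n with hKdef
  have hn' : (1:ℝ) ≤ n := by exact_mod_cast hn
  have hKR : (9:ℝ) * n ≤ K := by exact_mod_cast h9
  have hKR' : (K:ℝ) < 11 * n := by exact_mod_cast h11
  -- the four reverse-Chernoff bounds
  have g0 := exp_le_choose (N := 2 * K - (7 * n + 2)) (K := 8 * n) (by omega) (by omega) a0 b0
  have g1 := exp_le_choose (N := K - (3 * n + 1)) (K := 2 * n) (by omega) (by omega) a1 b1
  have g2 := exp_le_choose (N := 5 * n) (K := K - (6 * n + 1)) (by omega) (by omega) a2 b2
  have g3 := exp_le_choose (N := 5 * n) (K := K - (7 * n + 1)) (by omega) (by omega) a3 b3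
  have e0 : ((2 * K - (7 * n + 2) : ℕ) : ℝ) = 2 * K - 7 * n - 2 := by
    rw [Nat.cast_sub (by omega)]; push_cast; ring
  have e1 : ((K - (3 * n + 1) : ℕ) : ℝ) = K - 3 * n - 1 := by
    rw [Nat.cast_sub (by omega)]; push_cast; ring
  have e2 : ((K - (6 * n + 1) : ℕ) : ℝ) = K - 6 * n - 1 := by
    rw [Nat.cast_sub (by omega)]; push_cast; ring
  have e3 : ((K - (7 * n + 1) : ℕ) : ℝ) = K - 7 * n - 1 := by
    rw [Nat.cast_sub (by omega)]; push_cast; ring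
  rw [e0] at g0; rw [e1] at g1; rw [e2] at g2; rw [e3] at g3
  push_cast at g0 g1 g2 g3
  -- penalties are bounded
  have p0 : ((8 * n : ℝ) - s₀ ustarA * (2 * K - 7 * n - 2)) ^ 2 / ((2 * K - 7 * n - 2) * (s₀ ustarA * (1 - s₀ ustarA)))
      ≤ 9 / (s₀ ustarA * (1 - s₀ ustarA)) := by
    refine pen_le (by linarith) a0 b0 ?_
    have h7 : (0:ℝ) < 2 * ustarA - 7 := by linarith
    have e : (8 * n : ℝ) - s₀ ustarA * (2 * K - 7 * n - 2) = 8 * (2 * (ustarA * n - K) + 2) / (2 * ustarA - 7) := by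
      unfold s₀; field_simp; ring
    rw [e]
    have hx : 0 ≤ 8 * (2 * (ustarA * n - K) + 2) / (2 * ustarA - 7) := div_nonneg (by linarith) h7.le
    have hx' : 8 * (2 * (ustarA * n - K) + 2) / (2 * ustarA - 7) ≤ 3 := by
      rw [div_le_iff₀ h7]; linarith
    exact (pow_le_pow_left₀ hx hx' 2).trans (by norm_num)
  have p1 : ((2 * n : ℝ) - s₁ ustarA * (K - 3 * n - 1)) ^ 2 / ((K - 3 * n - 1) * (s₁ ustarA * (1 - s₁ ustarA)))
      ≤ 1 / (s₁ ustarA * (1 - s₁ ustarA)) := by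
    refine pen_le (by linarith) a1 b1 ?_
    have h3 : (0:ℝ) < ustarA - 3 := by linarith
    have e : (2 * n : ℝ) - s₁ ustarA * (K - 3 * n - 1) = 2 * ((ustarA * n - K) + 1) / (ustarA - 3) := by
      unfold s₁; field_simp; ring
    rw [e]
    have hx : 0 ≤ 2 * ((ustarA * n - K) + 1) / (ustarA - 3) := div_nonneg (by linarith) h3.le
    have hx' : 2 * ((ustarA * n - K) + 1) / (ustarA - 3) ≤ 1 := by
      rw [div_le_iff₀ h3]; linarith
    exact (pow_le_pow_left₀ hx hx' 2).trans (by norm_num)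
  have p2 : ((K - 6 * n - 1 : ℝ) - s₂ ustarA * (5 * n)) ^ 2 / ((5 * n) * (s₂ ustarA * (1 - s₂ ustarA)))
      ≤ 4 / (s₂ ustarA * (1 - s₂ ustarA)) := by
    refine pen_le (by linarith) a2 b2 ?_
    have e : (K - 6 * n - 1 : ℝ) - s₂ ustarA * (5 * n) = (K - ustarA * n) - 1 := by
      unfold s₂; field_simp; ring
    rw [e]
    have hx : (K - ustarA * n : ℝ) - 1 ≤ 2 := by linarith
    have hx' : -2 ≤ (K - ustarA * n : ℝ) - 1 := by linarith
    exact (sq_le_sq' hx' hx).trans (by norm_num)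
  have p3 : ((K - 7 * n - 1 : ℝ) - s₃ ustarA * (5 * n)) ^ 2 / ((5 * n) * (s₃ ustarA * (1 - s₃ ustarA)))
      ≤ 4 / (s₃ ustarA * (1 - s₃ ustarA)) := by
    refine pen_le (by linarith) a3 b3 ?_
    have e : (K - 7 * n - 1 : ℝ) - s₃ ustarA * (5 * n) = (K - ustarA * n) - 1 := by
      unfold s₃; field_simp; ring
    rw [e]
    have hx : (K - ustarA * n : ℝ) - 1 ≤ 2 := by linarith
    have hx' : -2 ≤ (K - ustarA * n : ℝ) - 1 := by linarith
    exact (sq_le_sq' hx' hx).trans (by norm_num)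
  -- logarithms of the block sizes
  have hl : ∀ x : ℝ, 1 ≤ x → x ≤ 15 * n → Real.log x ≤ Real.log (15 * n) := fun x hx hx' =>
    Real.log_le_log (by linarith) hx'
  have l0 := hl (2 * K - 7 * n - 2) (by linarith) (by linarith)
  have l1 := hl (K - 3 * n - 1) (by linarith) (by linarith)
  have l2 := hl (5 * n) (by linarith) (by linarith)
  -- assemble
  have hsum := affine_eq ustarA (n : ℝ) (K : ℝ)
  rw [hG, mul_zero, add_zero] at hsum
  have hprod := prod4_le (Real.exp_pos _).le (Real.exp_pos _).le (Real.exp_pos _).le (Real.exp_pos _).le g0 g1 g2 g3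
  rw [← Real.exp_add, ← Real.exp_add, ← Real.exp_add] at hprod
  have hcast : (termA n K : ℝ) = ((2 * K - (7 * n + 2)).choose (8 * n) : ℝ) * ((K - (3 * n + 1)).choose (2 * n) : ℝ) *
      ((5 * n).choose (K - (6 * n + 1)) : ℝ) * ((5 * n).choose (K - (7 * n + 1)) : ℝ) := by
    unfold termA; push_cast; ring
  rw [hcast]
  refine le_trans (Real.exp_le_exp.mpr ?_) hprod
  unfold C₁starA penPA
  linarith [hsum, p0, p1, p2, p3, l0, l1, l2]

/-- `qhatA n` dominates the near-critical summand (`n ≥ 1`). -/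
theorem termA_kcrit_le_qhatA {n : ℕ} (hn : 1 ≤ n) : termA n (kcritA n) ≤ qhatA n := by
  obtain ⟨h9, h11⟩ := kcritA_range hn
  unfold qhatA
  exact Finset.single_le_sum (f := fun k => termA n k) (fun _ _ => Nat.zero_le _)
    (Finset.mem_Ico.mpr ⟨by omega, by omega⟩)

/-- **Two-sided bounds** for `log (qhatA n)`, `n ≥ 1`. -/
theorem log_qhatA_bounds {n : ℕ} (hn : 1 ≤ n) :
    n * C₁starA + constKA ustarA - penPA - 2 * Real.log (15 * n) - 8 ≤ Real.log (qhatA n) ∧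
      Real.log (qhatA n) ≤ n * C₁starA + constKA ustarA + Real.log (5 * n + 1) := by
  have hlo := (exp_le_termA_kcrit hn).trans (by exact_mod_cast termA_kcrit_le_qhatA hn :
    (termA n (kcritA n) : ℝ) ≤ qhatA n)
  have hq : (0 : ℝ) < qhatA n := (Real.exp_pos _).trans_le hlo
  constructor
  · have := Real.log_le_log (Real.exp_pos _) hlo
    rwa [Real.log_exp] at this
  · have h := Real.log_le_log hq (qhatA_le n)
    have hpos : (0:ℝ) < 5 * n + 1 := by positivity
    rw [Real.log_mul hpos.ne' (Real.exp_pos _).ne', Real.log_exp] at h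
    linarith

/-! ### The limit -/

/-- **THE COEFFICIENT RATE EXISTS (unconditionally, for the partner sum):** `log (qhatA n) / n → C₁*`. -/
theorem tendsto_log_qhatA_div : Tendsto (fun n : ℕ => Real.log (qhatA n) / n) atTop (𝓝 C₁starA) := by
  have hA : Tendsto (fun n : ℕ => (constKA ustarA - penPA - 8) / (n : ℝ)) atTop (𝓝 0) :=
    tendsto_const_div_atTop_nhds_zero_nat _
  have hB : Tendsto (fun n : ℕ => Real.log (15 * n + 0) / (n : ℝ)) atTop (𝓝 0) :=
    tendsto_log_linear_div (by norm_num) le_rfl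
  have hC : Tendsto (fun n : ℕ => (constKA ustarA) / (n : ℝ)) atTop (𝓝 0) :=
    tendsto_const_div_atTop_nhds_zero_nat _
  have hD : Tendsto (fun n : ℕ => Real.log (5 * n + 1) / (n : ℝ)) atTop (𝓝 0) :=
    tendsto_log_linear_div (by norm_num) (by norm_num)
  have hlo : Tendsto (fun n : ℕ => C₁starA + ((constKA ustarA - penPA - 8) / (n : ℝ) - 2 * (Real.log (15 * n + 0) / n)))
      atTop (𝓝 C₁starA) := by
    simpa using tendsto_const_nhds.add (hA.sub (hB.const_mul 2))
  have hhi : Tendsto (fun n : ℕ => C₁starA + ((constKA ustarA) / (n : ℝ) + Real.log (5 * n + 1) / n))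
      atTop (𝓝 C₁starA) := by
    simpa using tendsto_const_nhds.add (hC.add hD)
  refine tendsto_of_tendsto_of_tendsto_of_le_of_le' hlo hhi ?_ ?_
  · filter_upwards [eventually_ge_atTop 1] with n hn
    have hnpos : (0:ℝ) < n := by exact_mod_cast hn
    have h := (log_qhatA_bounds hn).1
    rw [add_zero]
    have e : C₁starA + ((constKA ustarA - penPA - 8) / (n : ℝ) - 2 * (Real.log (15 * n) / n)) =
        (n * C₁starA + constKA ustarA - penPA - 2 * Real.log (15 * n) - 8) / n := by
      field_simp; ring
    rw [e]
    exact div_le_div_of_nonneg_right h hnpos.le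
  · filter_upwards [eventually_ge_atTop 1] with n hn
    have hnpos : (0:ℝ) < n := by exact_mod_cast hn
    have h := (log_qhatA_bounds hn).2
    have e : C₁starA + ((constKA ustarA) / (n : ℝ) + Real.log (5 * n + 1) / n) =
        (n * C₁starA + constKA ustarA + Real.log (5 * n + 1)) / n := by
      field_simp; ring
    rw [e]
    exact div_le_div_of_nonneg_right h hnpos.le

/-- **`CoeffRateA C₁*` from Whipple.** -/
theorem coeffRateA_of_whipple (hW : WhippleA) : CoeffRateA C₁starA := by
  unfold CoeffRateA
  refine tendsto_log_qhatA_div.congr' ?_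
  filter_upwards [eventually_ge_atTop 1] with n hn
  rw [hW n hn]
  push_cast
  rw [abs_neg, abs_of_nonneg (Nat.cast_nonneg _)]

/-! ### Positivity of the rate -/

/-- A crude lower bound: `4^{2n} ≤ (4n+1)·qhatA n` (the summand at `k = 8n+1` contains `C(5n, 2n) ≥ C(4n, 2n)`). -/
theorem four_pow_le_qhatA {n : ℕ} (hn : 1 ≤ n) : 4 ^ (2 * n) ≤ (4 * n + 1) * qhatA n := by
  have hk : termA n (8 * n + 1) ≤ qhatA n := by
    unfold qhatA
    exact Finset.single_le_sum (f := fun k => termA n k) (fun _ _ => Nat.zero_le _)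
      (Finset.mem_Ico.mpr ⟨by omega, by omega⟩)
  have hA : Nat.centralBinom (2 * n) ≤ termA n (8 * n + 1) := by
    unfold termA
    have e1 : 2 * (8 * n + 1) - (7 * n + 2) = 9 * n := by omega
    have e2 : 8 * n + 1 - (3 * n + 1) = 5 * n := by omega
    have e3 : 8 * n + 1 - (6 * n + 1) = 2 * n := by omega
    have e4 : 8 * n + 1 - (7 * n + 1) = n := by omega
    rw [e1, e2, e3, e4, Nat.centralBinom_eq_two_mul_choose, show 2 * (2 * n) = 4 * n by ring]
    have h1 : 1 ≤ (9 * n).choose (8 * n) := Nat.choose_pos (by omega)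
    have h2 : (4 * n).choose (2 * n) ≤ (5 * n).choose (2 * n) := Nat.choose_le_choose (2 * n) (by omega)
    have h3 : 1 ≤ (5 * n).choose (2 * n) := Nat.choose_pos (by omega)
    have h4 : 1 ≤ (5 * n).choose n := Nat.choose_pos (by omega)
    calc (4 * n).choose (2 * n) = 1 * (4 * n).choose (2 * n) * 1 * 1 := by ring
      _ ≤ (9 * n).choose (8 * n) * (5 * n).choose (2 * n) * (5 * n).choose (2 * n) * (5 * n).choose n := by
          gcongr
  have hc := Nat.four_pow_le_two_mul_self_mul_centralBinom (2 * n) (by omega)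
  calc 4 ^ (2 * n) ≤ 2 * (2 * n) * Nat.centralBinom (2 * n) := hc
    _ ≤ (4 * n + 1) * qhatA n := by
        rw [show 2 * (2 * n) = 4 * n by ring]
        exact Nat.mul_le_mul (by omega) (hA.trans hk)

/-- **`C₁* > 0`** (indeed `C₁* ≥ 2 log 4`). -/
theorem C₁starA_pos : 0 < C₁starA := by
  have hlow : Tendsto (fun n : ℕ => 2 * Real.log 4 - Real.log (4 * n + 1) / n) atTop (𝓝 (2 * Real.log 4)) := by
    simpa using tendsto_const_nhds.sub (tendsto_log_linear_div (a := 4) (b := 1) (by norm_num) (by norm_num))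
  have hle : 2 * Real.log 4 ≤ C₁starA := by
    refine le_of_tendsto_of_tendsto hlow tendsto_log_qhatA_div ?_
    filter_upwards [eventually_ge_atTop 1] with n hn
    have h := four_pow_le_qhatA hn
    have hq : 0 < qhatA n := by
      rcases Nat.eq_zero_or_pos (qhatA n) with h0 | h0
      · rw [h0, mul_zero] at h
        have := Nat.one_le_pow (2 * n) 4 (by norm_num)
        omega
      · exact h0
    have hR : (4:ℝ) ^ (2 * n) ≤ (4 * n + 1) * (qhatA n : ℝ) := by exact_mod_cast h
    have hq' : (0:ℝ) < qhatA n := by exact_mod_cast hq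
    have hlog := Real.log_le_log (by positivity) hR
    rw [Real.log_pow, Real.log_mul (by positivity) hq'.ne'] at hlog
    have hnpos : (0:ℝ) < n := by exact_mod_cast hn
    push_cast at hlog
    rw [sub_le_iff_le_add, ← add_div, le_div_iff₀ hnpos]
    linarith
  exact lt_of_lt_of_le (mul_pos (by norm_num) (Real.log_pos (by norm_num))) hle

/-! ### Packaged: the rung-A measure implication with the growth input discharged by Whipple -/

section Packaged

open Literature.NumberTheory.Transcendental (zetaValue)
open Summit.KontsevichZagierPeriods.Zeta5Search.Denom.TwoTaleR3Saving (savingRateA savingRateA_bounds)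
open Summit.KontsevichZagierPeriods.Zeta5Search.Denom.TwoTaleR3Forms (InclusionA DecayA exponentLE_of_inputsA
  zetaTwo_exponent_le_of_inputsA zetaTwo_exponent_le_looseA)

/-- **Generic rung-A measure from (InclusionA, DecayA c, WhippleA)**, `S = savingRateA`. -/
theorem exponentLE_of_whippleA {c : ℝ} (hI : InclusionA) (hD : DecayA c) (hW : WhippleA)
    (hc : 14 - savingRateA < c) :
    ExponentLE (zetaValue 2) (1 + (C₁starA + (14 - savingRateA)) / (c - (14 - savingRateA))) :=
  exponentLE_of_inputsA hI hD (coeffRateA_of_whipple hW) hc C₁starA_pos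

/-- **Rung A numerically** (fam-denom's `zetaTwo_exponent_le_of_inputsA` with `CoeffRateA`, `0 < C₁` replaced by
`WhippleA` and the enclosure `C₁* ≤ 18.7553`, which `TwoTaleR3GrowthEnclosure.C₁starA_le` proves): `μ(ζ(2)) ≤ 5.2054`
(printed model value `5.20514736…`). -/
theorem zetaTwo_exponent_le_of_whippleA (hI : InclusionA) (hD : DecayA 13.229) (hW : WhippleA)
    (hC₁ : C₁starA ≤ 18.7553) : ExponentLE (zetaValue 2) 5.2054 :=
  zetaTwo_exponent_le_of_inputsA hI hD (coeffRateA_of_whipple hW) C₁starA_pos hC₁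

/-- **Loose-constant variant**: `c = 13.2`, `C₁* ≤ 18.8` give `μ(ζ(2)) ≤ 5.233`. -/
theorem zetaTwo_exponent_le_looseA_of_whipple (hI : InclusionA) (hD : DecayA 13.2) (hW : WhippleA)
    (hC₁ : C₁starA ≤ 18.8) : ExponentLE (zetaValue 2) 5.233 :=
  zetaTwo_exponent_le_looseA hI hD (coeffRateA_of_whipple hW) C₁starA_pos hC₁

end Packaged

end Summit.KontsevichZagierPeriods.Zeta5Search.TwoTaleR3Growth

end
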